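/-
Copyright (c) 2026 the pub-hodgecm-mathlib formalisation cell (harness21).  Prover seat hodgecm-mathlib-K2E5-p16 (g6), Track B «K2-LIT»,
#184♮ = hLiu418 = `stmt-HodgeConjecture-24832`; S2-asm road (γ) ANCHOR PURE-TENSOR letter (LEAD F0P6-plan (g14) BATCH #27 (1), K2Liu-p05 (g5) hand-over
14:00:20Z), part 1 `K2LiuArchTensorKTypeComponents`: the sign-frame components of `k ⊗ 1` for EVERY arch element `k` —
`archUFormPi_𝕎 ((k ⊗ 1)_∞) σ = relabel eP eQ (toBig (archUFormPi_𝔻 k σ, 1))` — the `hk`∕`(A, B)` input of ★ J1 §4 `archSWValue_archFrameGauss_mul_right`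
for `K_∞`-elements.  THEOREMS ONLY (no `def`, no `instance`, no notation, no `sorry`).
-/
import Summits.HodgeConjecture.HodgeConjecture.Theorems.K2LiuArchTensorPlaceSec   -- ★ FILE 2b-2 (this seat): `signVec_tensor`, letters
import HarnessLib

/-!
# Crux `HLiu418`, S2-asm (γ) anchor letter, part 1: the sign-frame components of `k ⊗ 1`

Cell `hodgecm-mathlib`, crux item hLiu418 = `stmt-HodgeConjecture-24832` (helper lane `--supports`, count-neutral).

**`archUFormPi_tensorEmb`** — for EVERY `k ∈ U(J^𝔻)(L⁺ ⊗ ℝ)` and every real place `σ`: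
`archUFormPi_𝕎 (archPart (tensorEmb (archToAdelic k))) σ = UForm.relabel eP eQ (toBig (archUFormPi_𝔻 k σ, 1))` (frame identification `(eP, eQ)` compatible
through `dpEquiv`; `hz` by ★ `signVec_tensor`) — the general form of ★ FILE 2b-2's `archUFormPi_tensorEmb_placeSec_self` (`k := placeSec σ h`).  With
★ `K2LiuArchTensorSignFrames.det_submatrix_negIdx_kronecker_one(_of_eq)` (the `𝕎⁻`-block determinant `det(k₁)^{q′}·det(k₂)^{p′}`) and ★ `placeDiag_kV` it is
the `hk : placeDiag (archUFormPi k′) = kV (A, B)` input of ★ J1 §4 for `k ∈ K_∞` (anchor letter part 2).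
References: [KonnoKonno2007, §3.1 (3.1), Lemma 5.2]; [Kudla1994, §2]; [BorelJacquet1979, §4.1].
HONEST LABEL: HC_CM is proved only modulo the 7 printed citations (2 remaining named inputs: hLiu418 = stmt-HodgeConjecture-24832,
h413 = stmt-HodgeConjecture-24833) until rung 0 closes; count-neutral helper, closes no socket.
-/

set_option autoImplicit false
set_option linter.dupNamespace false

noncomputable section

open scoped Matrix Kronecker Classical
open NumberField NumberField.InfinitePlace NumberField.mixedEmbedding IsDedekindDomain

namespace Summit.HodgeConjecture.HodgeConjecture.Cruxes.HLiu418.K2LiuArchTensorKTypeComponents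

open Literature.NumberTheory.Automorphic Literature.NumberTheory.Automorphic.UnitaryGroup Literature.NumberTheory.Weil1964
open Literature.NumberTheory.GelbartRogawski1991 Literature.NumberTheory.GelbartRogawski1991.UnitaryDualPair
open Literature.NumberTheory.GelbartRogawski1991.UnitaryDualPair.LocalSplitting
open Literature.NumberTheory.GelbartRogawski1991.GRConstruction Literature.NumberTheory.K2Lit.SiegelDoubled
open Literature.RepresentationTheory.HeisenbergGroup Literature.Analysis.SegalBargmann
open Literature.RepresentationTheory.KonnoKonno2007 Literature.RepresentationTheory.KonnoKonno2007.RealDualPair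
open Summit.HodgeConjecture.HodgeConjecture.Cruxes.HLiu418 Summit.HodgeConjecture.HodgeConjecture.Cruxes.HLiu418.K2LiuArchSectionPlaceBlock

variable (L : Type) [Field L] [NumberField L] [IsCMField L]
variable {N M n : ℕ} (e : Fin N × Fin M ≃ Fin n)
  (dV : Fin N → L) (hdV : ∀ i, IsCMField.complexConj L (dV i) = dV i)
  (dW : Fin M → L) (hdW : ∀ i, IsCMField.complexConj L (dW i) = dW i)
variable {M₂ M' n' : ℕ} (eW : Fin M × Fin M₂ ≃ Fin M') (e' : Fin N × Fin M' ≃ Fin n')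
  (dV' : Fin M₂ → L) (hdV' : ∀ k, IsCMField.complexConj L (dV' k) = dV' k)

/-- **THE SIGN-FRAME COMPONENTS OF `k ⊗ 1` FOR EVERY `k`**: `archUFormPi_𝕎 ((k ⊗ 1)_∞) σ = relabel eP eQ (toBig (archUFormPi_𝔻 k σ, 1))`
(★ `coe_archUForm` on both data + ★ FILE 2b-1 `coe_archAt_archPart_tensorEmb` + ★ FILE 2a `reindex_signSplit_scaleConj_tensor` + ★ `coe_toBig`
+ ★ `UForm.coe_relabel`). [cite: KonnoKonno2007, §3.1 (3.1)] [cite: Kudla1994, §2 (doubled space, Siegel parabolic)] -/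
theorem archUFormPi_tensorEmb (hdV0 : ∀ i, dV i ≠ 0) (hdW0 : ∀ i, dW i ≠ 0) (hdV'0 : ∀ k, dV' k ≠ 0)
    (σ : {v : InfinitePlace (Fp L) // v.IsReal})
    (k : UnitaryGroup.arch (Fp L) L (IsCMField.complexConj L) (n + n) (hermD L e dV hdV dW hdW))
    (y : Fin M₂ → ℝ) (hy : ∀ k, y k ≠ 0)
    (hz : ∀ j, signVec (cmPlaceOver L)
        (fun k => Sum.elim (cmGramEntry L e' dV hdV (tensorFrame L dW eW dV') (tensorFrame_real L dW hdW eW dV' hdV'))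
          (-cmGramEntry L e' dV hdV (tensorFrame L dW eW dV') (tensorFrame_real L dW hdW eW dV' hdV')) ((e₂ n').symm k))
        (imagUnit L) σ j =
      signVec (cmPlaceOver L)
          (fun k => Sum.elim (cmGramEntry L e dV hdV dW hdW) (-cmGramEntry L e dV hdV dW hdW) ((e₂ n).symm k)) (imagUnit L) σ
          ((epsD e eW e').symm j).1 * y ((epsD e eW e').symm j).2)
    (eP : (PosIdx (signVec (cmPlaceOver L)
          (fun k => Sum.elim (cmGramEntry L e dV hdV dW hdW) (-cmGramEntry L e dV hdV dW hdW) ((e₂ n).symm k)) (imagUnit L) σ) × PosIdx y) ⊕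
        (NegIdx (signVec (cmPlaceOver L)
          (fun k => Sum.elim (cmGramEntry L e dV hdV dW hdW) (-cmGramEntry L e dV hdV dW hdW) ((e₂ n).symm k)) (imagUnit L) σ) × NegIdx y) ≃
      PosIdx (signVec (cmPlaceOver L)
        (fun k => Sum.elim (cmGramEntry L e' dV hdV (tensorFrame L dW eW dV') (tensorFrame_real L dW hdW eW dV' hdV'))
          (-cmGramEntry L e' dV hdV (tensorFrame L dW eW dV') (tensorFrame_real L dW hdW eW dV' hdV')) ((e₂ n').symm k))
        (imagUnit L) σ))
    (eQ : (PosIdx (signVec (cmPlaceOver L)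
          (fun k => Sum.elim (cmGramEntry L e dV hdV dW hdW) (-cmGramEntry L e dV hdV dW hdW) ((e₂ n).symm k)) (imagUnit L) σ) × NegIdx y) ⊕
        (NegIdx (signVec (cmPlaceOver L)
          (fun k => Sum.elim (cmGramEntry L e dV hdV dW hdW) (-cmGramEntry L e dV hdV dW hdW) ((e₂ n).symm k)) (imagUnit L) σ) × PosIdx y) ≃
      NegIdx (signVec (cmPlaceOver L)
        (fun k => Sum.elim (cmGramEntry L e' dV hdV (tensorFrame L dW eW dV') (tensorFrame_real L dW hdW eW dV' hdV'))
          (-cmGramEntry L e' dV hdV (tensorFrame L dW eW dV') (tensorFrame_real L dW hdW eW dV' hdV')) ((e₂ n').symm k))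
        (imagUnit L) σ))
    (hE : ∀ i, (dpEquiv _ _ _ _).symm ((eP.sumCongr eQ).symm i) =
      (signSplit (signVec (cmPlaceOver L)
          (fun k => Sum.elim (cmGramEntry L e dV hdV dW hdW) (-cmGramEntry L e dV hdV dW hdW) ((e₂ n).symm k)) (imagUnit L) σ)
        ((epsD e eW e').symm ((signSplit (signVec (cmPlaceOver L)
          (fun k => Sum.elim (cmGramEntry L e' dV hdV (tensorFrame L dW eW dV') (tensorFrame_real L dW hdW eW dV' hdV'))
            (-cmGramEntry L e' dV hdV (tensorFrame L dW eW dV') (tensorFrame_real L dW hdW eW dV' hdV')) ((e₂ n').symm k))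
          (imagUnit L) σ)).symm i)).1,
       signSplit y ((epsD e eW e').symm ((signSplit (signVec (cmPlaceOver L)
          (fun k => Sum.elim (cmGramEntry L e' dV hdV (tensorFrame L dW eW dV') (tensorFrame_real L dW hdW eW dV' hdV'))
            (-cmGramEntry L e' dV hdV (tensorFrame L dW eW dV') (tensorFrame_real L dW hdW eW dV' hdV')) ((e₂ n').symm k))
          (imagUnit L) σ)).symm i)).2)) :
    archUFormPi L (IsCMField.complexConj L) (n' + n') (IsCMField.complexConj_ne_one L) (cmPlaceOver L) (cmPlaceOver_smul L)
        (cmPlaceOver_comap L) _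
        (gramD_gram_realDiagonal_entry_ne_zero L e' dV hdV (tensorFrame L dW eW dV') (tensorFrame_real L dW hdW eW dV' hdV') hdV0
          (tensorFrame_ne_zero L dW eW dV' hdW0 hdV'0))
        (gramD_eq_diagonal_cm L e' dV hdV (tensorFrame L dW eW dV') (tensorFrame_real L dW hdW eW dV' hdV'))
        (J := hermD L e' dV hdV (tensorFrame L dW eW dV') (tensorFrame_real L dW hdW eW dV' hdV')) rfl
        (complexConj_imagUnit L) (imagUnit_ne_zero L)
        (UnitaryGroup.archPart (Fp L) L (IsCMField.complexConj L) (n' + n')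
          (hermD L e' dV hdV (tensorFrame L dW eW dV') (tensorFrame_real L dW hdW eW dV' hdV'))
          (tensorEmb L e dV hdV dW hdW eW e' dV' hdV'
            (UnitaryGroup.archToAdelic (Fp L) L (IsCMField.complexConj L) (n + n) (hermD L e dV hdV dW hdW) k))) σ =
      UForm.relabel _ _ _ _ eP eQ (toBig _ _ (PosIdx y) (NegIdx y)
        (archUFormPi L (IsCMField.complexConj L) (n + n) (IsCMField.complexConj_ne_one L) (cmPlaceOver L) (cmPlaceOver_smul L)
          (cmPlaceOver_comap L) _ (gramD_gram_realDiagonal_entry_ne_zero L e dV hdV dW hdW hdV0 hdW0) (gramD_eq_diagonal_cm L e dV hdV dW hdW)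
          (J := hermD L e dV hdV dW hdW) rfl (complexConj_imagUnit L) (imagUnit_ne_zero L) k σ, 1)) := by
  apply Subtype.ext
  apply Units.ext
  rw [archUFormPi_apply, coe_archUForm, UnitaryGroup.archPart_archToAdelic,
    K2LiuArchTensorEmbArchComponent.coe_archAt_archPart_tensorEmb, UnitaryGroup.archPart_archToAdelic]
  have hM := (coe_archUForm L (IsCMField.complexConj L) (n + n) (IsCMField.complexConj_ne_one L) (cmPlaceOver L) (cmPlaceOver_smul L)
    (cmPlaceOver_comap L) _ (hJ_diagonal L (n + n) _ (gramD_eq_diagonal_cm L e dV hdV dW hdW) (J := hermD L e dV hdV dW hdW) rfl) σ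
    (signSplit _) (sqrtAbs_signVec_ne_zero (IsCMField.complexConj_ne_one L) (cmPlaceOver_smul L) (complexConj_imagUnit L) (imagUnit_ne_zero L)
      (gramD_gram_realDiagonal_entry_ne_zero L e dV hdV dW hdW hdV0 hdW0) σ)
    (deltaIm_ne_zero (IsCMField.complexConj_ne_one L) (cmPlaceOver_smul L) (complexConj_imagUnit L) (imagUnit_ne_zero L) σ)
    (ht_signVec (IsCMField.complexConj_ne_one L) (cmPlaceOver_smul L) (complexConj_imagUnit L) (imagUnit_ne_zero L)
      (gramD_gram_realDiagonal_entry_ne_zero L e dV hdV dW hdW hdV0 hdW0) σ)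
    (UnitaryGroup.archToAdelic (Fp L) L (IsCMField.complexConj L) (n + n) (hermD L e dV hdV dW hdW) k)).symm
  rw [UnitaryGroup.archPart_archToAdelic] at hM
  rw [K2LiuArchTensorFrameChase.reindex_signSplit_scaleConj_tensor _ _ (epsD e eW e') _ _ (fun k => Real.sqrt |y k|)
      (fun k => (Real.sqrt_pos.2 (abs_pos.2 (hy k))).ne') _
      (K2LiuArchTensorPlaceSecMatrix.sqrtAbs_tensor _ _ (epsD e eW e') _ hz) _ _ hE, hM, UForm.coe_relabel, coe_toBig]
  simp [archUFormPi_apply]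

end Summit.HodgeConjecture.HodgeConjecture.Cruxes.HLiu418.K2LiuArchTensorKTypeComponents

end
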